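/-
Copyright (c) 2026 the pub-hodgecm-mathlib formalisation cell (harness21).  Prover seat hodgecm-mathlib-K2Liu-p10 (g2), Track B «K2-LIT»,
#184♮ = hLiu418 = `stmt-HodgeConjecture-24832`; ROAD Φ (RULING «M-156n» G5), K2E5-plan (g6) co-deal 08:16:30Z ∕ binding 08:19:27Z (4): G5-a = Φ7-2, the
RANK-0 (S = 0) TERM PACKAGE — file 1 = sub-organ (γ) «PACKAGING OF THE MIDDLE CELL» of census `K2/K2Liu-p10/g2/CENSUS-G5a-RankZeroTermPackage.K2Liu-p10-g2.md`
e9384fba425ca502.  THEOREMS ONLY (no `def`, no `instance`, no named-fact hypothesis, no `sorry`); hypothesis-first ((α) `hMID`, (β) Godement form, (δ) growth BY VALUE).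
-/
import Summits.HodgeConjecture.HodgeConjecture.Theorems.K2LiuGL2BorelEisensteinContinuation
import Summits.HodgeConjecture.HodgeConjecture.Theorems.K2LiuContinuityFromHalfPlane
import Mathlib.Analysis.SpecialFunctions.Pow.Real
import HarnessLib

/-!
# Crux `HLiu418`, ROAD Φ, organ Φ7-2 (γ): THE MIDDLE CELL OF THE CONSTANT TERM AS A (P,E⋆)-TERM PACKAGE WITH `P = {½}` — from its expression as a
# finite sum of `GL_k(𝔸_L)` mirabolic Eisenstein series of GODEMENT sections at `s + ½` (★ Φ7c ∕ `tateNumeratorGL`)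

Cell `hodgecm-mathlib`, crux item hLiu418 = `stmt-HodgeConjecture-24832` (helper lane, count-neutral).  The `S = 0` Fourier coefficient of `E^Δ(h; f_s)` is its
constant term `(∫β)·f_s(h) + M(s)f_s(h) + MID(s,h)` (★ O41.4 `constTerm_three_cells`); the middle cell `MID` is (sub-organs (α)(β) of the census, to be typed)
a FINITE SUM `MID(s, x) = Σ_j a_j(s, x) · E(g_j(x), Φ_j; s + ½)` of mirabolic (for `k = 2`: Borel) Eisenstein series of Godement sections over `L`
(★ `MirabolicEisensteinSeries.mirabolicEisenstein`), absolutely convergent for `re s > ½`, with coefficients `a_j` holomorphic on `{0 < re}` and of moderate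
growth, and Levi coordinates `g_j(x)` of height `≤ C₀‖x‖^{A₀}`.  THIS FILE (abstract `X` in place of `H(𝔸)`, any `k ≥ 1`, any height `X → ℝ_{>0}`) turns such a sum
into a TERM PACKAGE in the currency of ★ Φ9 `K2LiuSiegelEisensteinAssembly` ∕ ★ `K2LiuContinuationPackageAlgebra`:
  `MID⋆(s, x) := Σ_j a_j(s, x) · E*(s + ½, g_j(x)) ∕ (s + ½)`,  `E* = tateNumeratorGL` (★ `RankinSelbergIntegralEntire`, ENTIRE, `= s′(s′−1)E` on `re s′ > 1`),
so that (iv) `MID⋆ = (s − ½)·MID` on the convergence half-plane (`(s+½)(s−½)E(…; s+½) = E*(s+½, ·)`), (i) `MID⋆(·, x)` is HOLOMORPHIC on `{0 < re}` (`s + ½ ≠ 0` there —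
the pole `s = ½` of `E(·; s+½)` is CLEARED by the factor `(s − ½)`: `P = {½}`), (v) GROWTH `‖MID⋆(s,x)‖ ≤ C‖x‖^A` locally uniformly in `s` from the by-value growth of
the `a_j`, of `E*` in the `GL_k`-height (sub-organ (δ): Siegel sets + `GL_k(L)`-invariance ★ `tateNumeratorGL_mul_of_mem_quotientSubgroup` + ★
`exists_tsum_lintegral_vecMul_mul_le_of_mem_piSchwartzBruhat`) and the height comparison `‖g_j(x)‖ ≤ C₀‖x‖^{A₀}`, and (ii) CONTINUITY of `MID⋆(s, ·)` for EVERY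
`0 < re s` by ★ `K2LiuContinuityFromHalfPlane.continuous_of_differentiableOn_halfPlane` (Vitali) from (i), (v) and the continuity of `MID(s, ·)` on the convergence
half-plane — NO continuity of the (Iwasawa-dependent, non-canonical) coordinates `a_j(s, ·)`, `g_j(·)` is needed.
HEAD: **`exists_middle_package`** `: ∃ E₇, (i) ∧ (ii) ∧ (iv with P = {½}) ∧ (v)`.
Sources: [MoeglinWaldspurger1995, II.1.7 (constant terms: Eisenstein series on the Levi of intertwined sections), IV.1.9]; [CogdellAnalyticTheory2004, §2.3];
[KudlaRallis1994, §1]; [Tan1999, §4 Prop. 4.8].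
HONEST LABEL.  Helper lemmas, count-neutral; `HC_CM` is proved only modulo the 7 printed citations (2 remaining named inputs:
hLiu418 = `stmt-HodgeConjecture-24832`, h413 = `stmt-HodgeConjecture-24833`) until rung 0 closes.
-/

set_option autoImplicit false
set_option linter.dupNamespace false -- the mandated namespace repeats `HodgeConjecture.HodgeConjecture`

noncomputable section

namespace Summit.HodgeConjecture.HodgeConjecture.Cruxes.HLiu418.K2LiuSiegelEisensteinRankZeroTermPackage

open Set Filter Topology Metric Complex
open scoped BigOperators MatrixGroups NNReal ENNReal
open NumberField IsDedekindDomain MeasureTheory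
open Literature.NumberTheory.Automorphic
open Literature.NumberTheory.GaloisRepresentations (ideleGroup)
open K2LiuGL2BorelEisensteinContinuation K2LiuContinuityFromHalfPlane

variable {L : Type} [Field L] [NumberField L] {k : ℕ}
variable [MeasurableSpace (AdeleRing (𝓞 L) L)] [BorelSpace (AdeleRing (𝓞 L) L)]
  (ν : Measure (ideleGroup L)) [ν.IsHaarMeasure] (μ : Measure (Fin k → AdeleRing (𝓞 L) L)) [μ.IsAddHaarMeasure]
variable {X : Type*} [TopologicalSpace X] [FirstCountableTopology X] {ι : Type*} [Fintype ι]

/-! ## 1. Elementary bounds -/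

omit [Fintype ι] in
/-- On the ball of radius `re z` round `z` one has `0 < re s` and `½ ≤ ‖s + ½‖`. [folklore] -/
theorem re_pos_and_half_le_of_dist_lt {z s : ℂ} (hs : dist s z < z.re) : 0 < s.re ∧ (1 : ℝ) / 2 ≤ ‖s + 1 / 2‖ := by
  have h1 : |s.re - z.re| ≤ dist s z := by
    rw [Complex.dist_eq]
    simpa using Complex.abs_re_le_norm (s - z)
  have h2 := (abs_lt.1 (lt_of_le_of_lt h1 hs)).1
  have hsre : 0 < s.re := by linarith
  refine ⟨hsre, ?_⟩
  have h3 : (s + 1 / 2).re ≤ ‖s + 1 / 2‖ := Complex.re_le_norm _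
  have h4 : (s + 1 / 2).re = s.re + 1 / 2 := by simp
  linarith

/-! ## 2. The middle package -/

/-- **Φ7-2 (γ): THE MIDDLE CELL AS A TERM PACKAGE WITH `P = {½}`.**  DATA (by value): a height `height : X → ℝ` (positive, bounded on compacts), a finite family of
Schwartz data `Φ j ∈ 𝒮(𝔸_Lᵏ)`, coordinates `g j : X → GL_k(𝔸_L)` of height `≤ C₀·height^A₀`, coefficients `a j : ℂ → X → ℂ` holomorphic on `{0 < re}` in `s`
with `‖a j s x‖ ≤ C_a·height x^{A_a}` near every `z` (`0 < re z`), the GROWTH of the continued mirabolic series `‖E*(s′, g)‖ ≤ C_E·‖g‖^{A_E}` near every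
`z′` with `½ < re z′` (sub-organ (δ)), and `MID : ℂ → X → ℂ` continuous in `x` and EQUAL to `Σ_j a j s x · E(g j x, Φ j; s + ½)` for `c < re s` (`½ ≤ c`;
sub-organs (α)(β)).  THEN there is `E₇ : ℂ → X → ℂ` with (i) `s ↦ E₇ s x` holomorphic on `{0 < re}`, (ii) `E₇ s` continuous for `0 < re s`, (iv)
`E₇ s x = (s − ½)·MID s x` for `c < re s`, (v) `‖E₇ s x‖ ≤ C·height x^A` locally uniformly in `s` — the (P,E⋆)-package of the middle cell, `P = {½}`.
[cite: MoeglinWaldspurger1995, II.1.7, IV.1.9] [cite: CogdellAnalyticTheory2004, §2.3 Thm. 2.2] [cite: Tan1999, §4 Prop. 4.8] -/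
theorem exists_middle_package (hk : 0 < k) {𝓕 : Set (ideleGroup L)} (h𝓕 : IsIdeleClassDomain L 𝓕)
    (height : X → ℝ) (hpos : ∀ x, 0 < height x) (hcpt : ∀ K : Set X, IsCompact K → ∃ B : ℝ, ∀ x ∈ K, height x ≤ B)
    (Φ : ι → (Fin k → AdeleRing (𝓞 L) L) → ℂ) (hΦ : ∀ j, Φ j ∈ piSchwartzBruhat L (Fin k))
    (g : ι → X → GL (Fin k) (AdeleRing (𝓞 L) L)) {C₀ A₀ : ℝ} (hC₀ : 0 ≤ C₀) (hA₀ : 0 ≤ A₀)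
    (hg : ∀ j x, adelicHeightGL k L (g j x) ≤ C₀ * height x ^ A₀)
    (a : ι → ℂ → X → ℂ) (had : ∀ j x, DifferentiableOn ℂ (fun s => a j s x) {s : ℂ | 0 < s.re})
    (hag : ∀ z : ℂ, 0 < z.re → ∃ C A r : ℝ, 0 ≤ C ∧ 0 ≤ A ∧ 0 < r ∧ ∀ s : ℂ, dist s z < r → ∀ j x, ‖a j s x‖ ≤ C * height x ^ A)
    (hEg : ∀ z' : ℂ, 1 / 2 < z'.re → ∃ C A r : ℝ, 0 ≤ C ∧ 0 ≤ A ∧ 0 < r ∧ ∀ s' : ℂ, dist s' z' < r →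
      ∀ j (gg : GL (Fin k) (AdeleRing (𝓞 L) L)), ‖tateNumeratorGL ν μ 𝓕 (Φ j) s' gg‖ ≤ C * adelicHeightGL k L gg ^ A)
    (hHpos : ∀ gg : GL (Fin k) (AdeleRing (𝓞 L) L), 0 < adelicHeightGL k L gg)
    {c : ℝ} (hc : 1 / 2 ≤ c) (MID : ℂ → X → ℂ) (hMIDc : ∀ s : ℂ, c < s.re → Continuous (MID s))
    (hMID : ∀ (s : ℂ) (x : X), c < s.re → MID s x = ∑ j, a j s x * mirabolicEisenstein L ν (Φ j) (s + 1 / 2) (g j x)) :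
    ∃ E₇ : ℂ → X → ℂ,
      (∀ x, DifferentiableOn ℂ (fun s => E₇ s x) {s : ℂ | 0 < s.re}) ∧
      (∀ s : ℂ, 0 < s.re → Continuous (E₇ s)) ∧
      (∀ (s : ℂ) (x : X), c < s.re → E₇ s x = (∏ p ∈ ({1 / 2} : Finset ℂ), (s - p)) * MID s x) ∧
      (∀ z : ℂ, 0 < z.re → ∃ C A r : ℝ, 0 < r ∧ ∀ s : ℂ, dist s z < r → ∀ x, ‖E₇ s x‖ ≤ C * height x ^ A) := by
  -- the package
  set E₇ : ℂ → X → ℂ := fun s x => ∑ j, a j s x * (tateNumeratorGL ν μ 𝓕 (Φ j) (s + 1 / 2) (g j x) / (s + 1 / 2)) with hE₇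
  -- (i) holomorphy on `{0 < re}`
  have hd : ∀ x, DifferentiableOn ℂ (fun s => E₇ s x) {s : ℂ | 0 < s.re} := by
    intro x s hs
    have hs0 : 0 < s.re := hs
    have hs' : (s + 1 / 2 : ℂ) ≠ 0 := fun h0 => by
      have := congrArg Complex.re h0
      simp at this
      linarith
    have hN : ∀ j, DifferentiableAt ℂ (fun s => tateNumeratorGL ν μ 𝓕 (Φ j) (s + 1 / 2) (g j x) / (s + 1 / 2)) s := fun j =>
      (((differentiable_tateNumeratorGL ν μ h𝓕 (hΦ j) (g j x)).comp (differentiable_id.add_const _)).differentiableAt).div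
        (differentiableAt_id.add_const _) hs'
    exact DifferentiableWithinAt.fun_sum fun j _ => (had j x s hs).mul (hN j).differentiableWithinAt
  -- (iv) agreement on `c < re s`
  have heq : ∀ (s : ℂ) (x : X), c < s.re → E₇ s x = (∏ p ∈ ({1 / 2} : Finset ℂ), (s - p)) * MID s x := by
    intro s x hs
    rw [Finset.prod_singleton, hMID s x hs, Finset.mul_sum]
    refine Finset.sum_congr rfl fun j _ => ?_
    have hs1 : 1 < (s + 1 / 2).re := by
      have : (s + 1 / 2).re = s.re + 1 / 2 := by simp
      rw [this]; linarith
    have hs' : (s + 1 / 2 : ℂ) ≠ 0 := fun h0 => by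
      have := congrArg Complex.re h0
      simp at this; linarith
    rw [tateNumeratorGL_eq_mul_mirabolicEisenstein ν μ hk h𝓕 (hΦ j) hs1 (g j x), mul_assoc (s + 1 / 2), mul_div_cancel_left₀ _ hs']
    ring
  -- (v) growth (with signs recorded, for the compact bound of (ii))
  have hgrowth : ∀ z : ℂ, 0 < z.re → ∃ C A r : ℝ, 0 ≤ C ∧ 0 ≤ A ∧ 0 < r ∧ ∀ s : ℂ, dist s z < r → ∀ x, ‖E₇ s x‖ ≤ C * height x ^ A := by
    intro z hz
    obtain ⟨Ca, Aa, ra, hCa, hAa, hra, ha⟩ := hag z hz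
    have hz' : 1 / 2 < (z + 1 / 2).re := by
      have : (z + 1 / 2).re = z.re + 1 / 2 := by simp
      rw [this]; linarith
    obtain ⟨CE, AE, rE, hCE, hAE, hrE, hE⟩ := hEg (z + 1 / 2) hz'
    refine ⟨(Fintype.card ι : ℝ) * (Ca * (2 * (CE * C₀ ^ AE))), Aa + A₀ * AE, min (min ra rE) z.re,
      by positivity, by positivity, lt_min (lt_min hra hrE) hz, fun s hs x => ?_⟩
    have hsra : dist s z < ra := lt_of_lt_of_le hs ((min_le_left _ _).trans (min_le_left _ _))
    have hsrE : dist (s + 1 / 2) (z + 1 / 2) < rE := by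
      rw [dist_eq_norm, show s + 1 / 2 - (z + 1 / 2) = s - z by ring, ← dist_eq_norm]
      exact lt_of_lt_of_le hs ((min_le_left _ _).trans (min_le_right _ _))
    obtain ⟨_, hhalf⟩ := re_pos_and_half_le_of_dist_lt (lt_of_lt_of_le hs (min_le_right _ _))
    have hx := hpos x
    have hC₀AE : 0 ≤ C₀ ^ AE := Real.rpow_nonneg hC₀ _
    -- `‖E*(s+½, g j x)‖ ≤ CE C₀^AE height^(A₀ AE)`
    have hN : ∀ j, ‖tateNumeratorGL ν μ 𝓕 (Φ j) (s + 1 / 2) (g j x)‖ ≤ CE * C₀ ^ AE * height x ^ (A₀ * AE) := by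
      intro j
      refine (hE _ hsrE j (g j x)).trans ?_
      rw [mul_assoc]
      refine mul_le_mul_of_nonneg_left ?_ hCE
      calc adelicHeightGL k L (g j x) ^ AE ≤ (C₀ * height x ^ A₀) ^ AE :=
            Real.rpow_le_rpow (hHpos _).le (hg j x) hAE
        _ = C₀ ^ AE * height x ^ (A₀ * AE) := by
            rw [Real.mul_rpow hC₀ (Real.rpow_nonneg hx.le _), ← Real.rpow_mul hx.le]
    -- termwise bound
    have hterm : ∀ j, ‖a j s x * (tateNumeratorGL ν μ 𝓕 (Φ j) (s + 1 / 2) (g j x) / (s + 1 / 2))‖ ≤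
        Ca * (2 * (CE * C₀ ^ AE)) * height x ^ (Aa + A₀ * AE) := by
      intro j
      have h1 : ‖a j s x‖ ≤ Ca * height x ^ Aa := ha s hsra j x
      have h2 : ‖tateNumeratorGL ν μ 𝓕 (Φ j) (s + 1 / 2) (g j x) / (s + 1 / 2)‖ ≤ 2 * (CE * C₀ ^ AE) * height x ^ (A₀ * AE) := by
        rw [norm_div, div_le_iff₀ (lt_of_lt_of_le (by norm_num) hhalf)]
        calc ‖tateNumeratorGL ν μ 𝓕 (Φ j) (s + 1 / 2) (g j x)‖ ≤ CE * C₀ ^ AE * height x ^ (A₀ * AE) := hN j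
          _ = CE * C₀ ^ AE * height x ^ (A₀ * AE) * 1 := (mul_one _).symm
          _ ≤ CE * C₀ ^ AE * height x ^ (A₀ * AE) * (2 * ‖s + 1 / 2‖) := by
              refine mul_le_mul_of_nonneg_left (by linarith) ?_
              exact mul_nonneg (mul_nonneg hCE hC₀AE) (Real.rpow_nonneg hx.le _)
          _ = 2 * (CE * C₀ ^ AE) * height x ^ (A₀ * AE) * ‖s + 1 / 2‖ := by ring
      calc ‖a j s x * (tateNumeratorGL ν μ 𝓕 (Φ j) (s + 1 / 2) (g j x) / (s + 1 / 2))‖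
          = ‖a j s x‖ * ‖tateNumeratorGL ν μ 𝓕 (Φ j) (s + 1 / 2) (g j x) / (s + 1 / 2)‖ := norm_mul _ _
        _ ≤ (Ca * height x ^ Aa) * (2 * (CE * C₀ ^ AE) * height x ^ (A₀ * AE)) :=
            mul_le_mul h1 h2 (norm_nonneg _) (mul_nonneg hCa (Real.rpow_nonneg hx.le _))
        _ = Ca * (2 * (CE * C₀ ^ AE)) * (height x ^ Aa * height x ^ (A₀ * AE)) := by ring
        _ = Ca * (2 * (CE * C₀ ^ AE)) * height x ^ (Aa + A₀ * AE) := by rw [← Real.rpow_add hx]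
    calc ‖E₇ s x‖ ≤ ∑ j, ‖a j s x * (tateNumeratorGL ν μ 𝓕 (Φ j) (s + 1 / 2) (g j x) / (s + 1 / 2))‖ := norm_sum_le _ _
      _ ≤ ∑ _j : ι, Ca * (2 * (CE * C₀ ^ AE)) * height x ^ (Aa + A₀ * AE) := Finset.sum_le_sum fun j _ => hterm j
      _ = (Fintype.card ι : ℝ) * (Ca * (2 * (CE * C₀ ^ AE))) * height x ^ (Aa + A₀ * AE) := by
          rw [Finset.sum_const, Finset.card_univ, nsmul_eq_mul]; ring
  -- (ii) continuity, by Vitali from (i), (v) and the continuity of `MID` on the convergence half-plane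
  have hcont : ∀ s : ℂ, 0 < s.re → Continuous (E₇ s) := by
    intro s hs
    refine continuous_of_differentiableOn_halfPlane (a := 0) (c := c) (by linarith) E₇ hd (fun K hK z hz => ?_) (fun s' hs' => ?_) hs
    · obtain ⟨C, A, r, hC, hA, hr, hle⟩ := hgrowth z hz
      obtain ⟨B, hB⟩ := hcpt K hK
      refine ⟨C * max B 1 ^ A, r, hr, fun s' hs' x hx => (hle s' (mem_ball.1 hs') x).trans ?_⟩
      exact mul_le_mul_of_nonneg_left (Real.rpow_le_rpow (hpos x).le ((hB x hx).trans (le_max_left _ _)) hA) hC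
    · -- on `c < re s'`, `E₇ s' = (s' − ½)·MID s'` is continuous
      have h : Continuous fun x => (∏ p ∈ ({1 / 2} : Finset ℂ), (s' - p)) * MID s' x := continuous_const.mul (hMIDc s' hs')
      exact h.congr fun x => (heq s' x hs').symm
  exact ⟨E₇, hd, hcont, heq, fun z hz => by
    obtain ⟨C, A, r, _, _, hr, hle⟩ := hgrowth z hz
    exact ⟨C, A, r, hr, hle⟩⟩


end Summit.HodgeConjecture.HodgeConjecture.Cruxes.HLiu418.K2LiuSiegelEisensteinRankZeroTermPackage

end
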